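import Mathlib
import Summits.HubbardSuperconductivity.HubbardSuperconductivity.Theorems.KLProgrammeH10TwoPointLimitSectorCount2n
import Summits.HubbardSuperconductivity.HubbardSuperconductivity.Theorems.KLProgrammeSectorCountShellInclusion
import HarnessLib

/-!
# Route KLProgramme — crux K1 `H10TwoPointLimit`: the `2n`-leg sector count under ARBITRARY leg constraints
inside a thick shell and APPROXIMATE momentum conservation (master form of the shell inclusion)

Helper for stub `stub_H10_mu_of_count : CountPairsOffset → H10AnalysisWindow` of the registered skeleton of K1
(stmt-HubbardSuperconductivity-19938); AUDIT-A1A2 §2 row 2.12 / GAP-LEDGER G-002 at EVERY leg number, and the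
«O(w) slack on the anchored momentum» of COUNTING-NOTE-2 §5 (endpoint count (E)). The `2n`-leg isotropic sector
count modulo `2πℤ²` (`h10_twoNSectorCount_of_countPairsOffset`) counts momenta of the shell `|ε - μ| ≤ w`,
`w = π/2ⁿ` the sector width, of the FREE band with EXACT conservation `Σ k = 2πG`; its four-leg case with thick /
perturbed shells is `klsc_fourSectorCount_*` (`KLProgrammeSectorCountShellInclusion.lean`). The multiscale analysis
counts momenta in supports of scale-`h` propagators — shells of a fixed multiple of `w` of a PERTURBED dispersion
`ε_h`, `sup |ε_h - ε| ≤ C|U||h|γ^{2h}` (Benfatto–Giuliani–Mastropietro 2006, (2.36)) — and may know the anchored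
momenta only to `O(w)`. All of it is absorbed by inclusion of the counted sets: the MASTER COUNT
`h10_twoNSectorCount_subset_of_countPairsOffset` bounds, for every window `[μ₁, μ₂] ⊂ (-4, 0)`, every number `m`
of fixed legs and every real `c`, `s`, the number of sector triples admitting momenta subject to ARBITRARY per-leg
constraints implying `|ε(k) - μ| ≤ c·w`, in the prescribed sectors, with `|Σ k - 2πG|_∞ ≤ s·w`, by
`K(μ₁, μ₂, m, c, s)·2ⁿ·(n+1)`. The exact-conservation thick / perturbed instances are in
`KLProgrammeH10TwoPointLimitSectorCount2nShellForms.lean`. Conditional on the route's support item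
`CountPairsOffset` (stmt-HubbardSuperconductivity-20036) exactly like `h10_twoNSectorCount_of_countPairsOffset`.
-/

open Classical

noncomputable section

-- the tree's namespace `Summit.<Summit>.<Problem>.Theorems` repeats the summit name by design (D-0017)
set_option linter.dupNamespace false

open Real Set Literature.MathematicalPhysics.QuantumLattice Literature.MathematicalPhysics.QuantumLattice.BandSectorCounting

namespace Summit.HubbardSuperconductivity.HubbardSuperconductivity.Theorems

/-- **Cell geometry for the shell `|ε - μ| ≤ c·w`, `1 ≤ c`**: the deviation from `p_μ(θ_ω)` is at most
`c·D·w`, `D = 1/Dt_min + s_max/2` the tree's cell constant (from `klsc_cell`, the cell geometry for a shell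
of arbitrary thickness). -/
theorem h10_cell_thick_mul {a b : ℝ} (B : BandBounds a b) {μ : ℝ} (hμ : μ ∈ Icc a b)
    {k : Fin 2 → ℝ} {n ω : ℕ} {c m₀ : ℝ} (hc : 1 ≤ c) (hk : ∀ i, |k i| < π)
    (hshell : |sqDispersion k - μ| ≤ c * sectorWidth n) (ht : c * sectorWidth n ≤ m₀)
    (hlo : a ≤ μ - m₀) (hhi : μ + m₀ ≤ b)
    (hω : sectorIndex n (Complex.arg (⟨k 0, k 1⟩ : ℂ)) = ω) :
    |k 0 - bandX μ (sectorCenter n ω)| ≤ c * B.Dcell * sectorWidth n ∧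
      |k 1 - bandY μ (sectorCenter n ω)| ≤ c * B.Dcell * sectorWidth n := by
  have h := klsc_cell B hμ hk hshell ht hlo hhi hω
  have hD := B.Dtmin_pos; have hs := B.smax_pos; have hw := sectorWidth_pos n
  have hle : c * sectorWidth n / B.Dtmin + B.smax * (sectorWidth n / 2) ≤ c * B.Dcell * sectorWidth n := by
    unfold BandBounds.Dcell
    have e : c * (1 / B.Dtmin + B.smax / 2) * sectorWidth n =
        c * sectorWidth n / B.Dtmin + c * (B.smax * (sectorWidth n / 2)) := by ring
    rw [e]
    have : B.smax * (sectorWidth n / 2) ≤ c * (B.smax * (sectorWidth n / 2)) :=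
      le_mul_of_one_le_left (by positivity) hc
    linarith
  exact ⟨h.1.trans hle, h.2.trans hle⟩

set_option maxHeartbeats 800000 in
/-- **The `2n`-leg isotropic sector count modulo `2πℤ²` under ARBITRARY momentum constraints inside a thick
shell, with approximate conservation** (master form; from `CountPairsOffset`). For every window
`[μ₁, μ₂] ⊂ (-4, 0)`, every number `m` of fixed legs and all reals `c`, `s` there is `K > 0` such that for all
`μ ∈ [μ₁, μ₂]`, scales `n` (`w = π/2ⁿ`), `G ∈ ℤ²`, fixed sectors `ω_f` and ALL per-leg constraints `S_f j`, `S l`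
on momenta of the open square implying `|ε(k) - μ| ≤ c·w`: the number of sector triples admitting constrained
momenta in the prescribed sectors with `|Σ k - 2πG|_∞ ≤ s·w` is `≤ K·2ⁿ·(n+1)` (Benfatto–Giuliani–Mastropietro
2006 Lemma 3.1 / App. A2 at every leg number, whole hole-doped band, counted shell and conservation slack decoupled
from the sector width). Proof: that of `h10_twoNSectorCount_of_countPairsOffset` with `cell` replaced by
`h10_cell_thick_mul` (`c' = max c 1`), box radius `r = ((m+3)c'D + s⁺)w`, tolerance `C_δ = 4((m+3)c'D + s⁺)` in
`CountPairsOffset`, coarse scales absorbed by `N³`. -/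
theorem h10_twoNSectorCount_subset_of_countPairsOffset
    (hC : Summit.HubbardSuperconductivity.HubbardSuperconductivity.Theses.KLProgramme.CountPairsOffset) :
    ∀ μ₁ μ₂ : ℝ, -4 < μ₁ → μ₁ ≤ μ₂ → μ₂ < 0 → ∀ (m : ℕ) (c s : ℝ), ∃ K : ℝ, 0 < K ∧
      ∀ μ ∈ Set.Icc μ₁ μ₂, ∀ (n : ℕ) (G : Fin 2 → ℤ) (ωf : Fin m → ℕ)
        (Sf : Fin m → (Fin 2 → ℝ) → Prop) (S : Fin 3 → (Fin 2 → ℝ) → Prop),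
        (∀ j k, (∀ i, |k i| < Real.pi) → Sf j k → |sqDispersion k - μ| ≤ c * sectorWidth n) →
        (∀ l k, (∀ i, |k i| < Real.pi) → S l k → |sqDispersion k - μ| ≤ c * sectorWidth n) →
        (((Finset.univ : Finset (Fin (sectorCount n) × Fin (sectorCount n) × Fin (sectorCount n))).filter
          (fun ω : Fin (sectorCount n) × Fin (sectorCount n) × Fin (sectorCount n) =>
            ∃ (kf : Fin m → Fin 2 → ℝ) (k : Fin 3 → Fin 2 → ℝ),
            (∀ j i, |kf j i| < Real.pi) ∧ (∀ l i, |k l i| < Real.pi) ∧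
            (∀ j, Sf j (kf j)) ∧ (∀ l, S l (k l)) ∧
            (∀ j, sectorIndex n (Complex.arg (⟨kf j 0, kf j 1⟩ : ℂ)) = ωf j) ∧
            sectorIndex n (Complex.arg (⟨k 0 0, k 0 1⟩ : ℂ)) = (ω.1 : ℕ) ∧
            sectorIndex n (Complex.arg (⟨k 1 0, k 1 1⟩ : ℂ)) = (ω.2.1 : ℕ) ∧
            sectorIndex n (Complex.arg (⟨k 2 0, k 2 1⟩ : ℂ)) = (ω.2.2 : ℕ) ∧
            (∀ i, |(∑ j, kf j i) + (∑ l, k l i) - 2 * Real.pi * (G i : ℝ)| ≤ s * sectorWidth n))).card : ℝ) ≤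
          K * 2 ^ n * ((n : ℝ) + 1) := by
  intro μ₁ μ₂ hμ₁ h12 hμ₂ m c s
  -- the effective thickness factor `c' = max c 1`
  set c' : ℝ := max c 1 with hc'def
  have hc'1 : 1 ≤ c' := le_max_right _ _
  have hcc' : c ≤ c' := le_max_left _ _
  have hc'pos : 0 < c' := lt_of_lt_of_le one_pos hc'1
  -- the effective slack `s⁺ = max s 0`
  set s' : ℝ := max s 0 with hs'def
  have hs'0 : 0 ≤ s' := le_max_right _ _
  have hss' : s ≤ s' := le_max_left _ _
  -- the level range `[a', b']` and its uniform bounds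
  have ha : -4 < (μ₁ - 4) / 2 := by linarith
  have hab : (μ₁ - 4) / 2 ≤ μ₂ / 2 := by linarith
  have hb : μ₂ / 2 < 0 := by linarith
  obtain ⟨B, -⟩ : ∃ B : BandBounds ((μ₁ - 4) / 2) (μ₂ / 2), B = bandBounds ha hab hb := ⟨_, rfl⟩
  have hm₀ : 0 < min (μ₁ - (μ₁ - 4) / 2) (μ₂ / 2 - μ₂) := lt_min (by linarith) (by linarith)
  set m₀ := min (μ₁ - (μ₁ - 4) / 2) (μ₂ / 2 - μ₂) with hm₀def
  have hD := B.Dcell_pos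
  have hum := B.umin_pos
  have hπ := Real.pi_pos
  -- the tolerance constant `C_δ = 4 (m+3) c' D` and the count
  obtain ⟨Cδ, hCδ⟩ : ∃ Cδ : ℝ, Cδ = 4 * (((m : ℝ) + 3) * c' * B.Dcell + s') := ⟨_, rfl⟩
  have hCδpos : 0 < Cδ := by rw [hCδ]; positivity
  obtain ⟨Kp, hKp, hcount⟩ := hC ((μ₁ - 4) / 2) (μ₂ / 2) ha hab hb m₀ Cδ hm₀ hCδpos
  -- the threshold on `w` and the two constants
  obtain ⟨w₀, hw₀⟩ : ∃ w₀ : ℝ, w₀ = min 1 (min (m₀ / c') (m₀ / (2 * Cδ))) := ⟨_, rfl⟩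
  have hw₀pos : 0 < w₀ := by rw [hw₀]; exact lt_min (by norm_num) (lt_min (by positivity) (by positivity))
  obtain ⟨C₀, hC₀⟩ : ∃ C₀ : ℝ,
      C₀ = 3 * (2 * (π * (Real.sqrt 2 * (((m : ℝ) + 3) * c' * B.Dcell + s') / B.umin)) + 1) := ⟨_, rfl⟩
  have hC₀pos : 0 < C₀ := by rw [hC₀]; positivity
  obtain ⟨K₁, hK₁⟩ : ∃ K₁ : ℝ, K₁ = 8 * (π / w₀) ^ 2 := ⟨_, rfl⟩
  obtain ⟨K₂, hK₂⟩ : ∃ K₂ : ℝ, K₂ = C₀ * Kp * 3 / π := ⟨_, rfl⟩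
  have hK₁pos : 0 < K₁ := by rw [hK₁]; positivity
  have hK₂pos : 0 < K₂ := by rw [hK₂]; positivity
  refine ⟨K₁ + K₂, by positivity, ?_⟩
  intro μ hμ n G ωf Sf S hSf hS
  have hwpos : 0 < sectorWidth n := sectorWidth_pos n
  have hNw : (sectorCount n : ℝ) * sectorWidth n = 2 * π := sectorCount_mul_sectorWidth n
  have h2n : (2 : ℝ) ^ n * sectorWidth n = π := by rw [sectorWidth]; field_simp
  have hNeq : sectorCount n = 2 * 2 ^ n := by unfold sectorCount; ring
  have hNreal : (sectorCount n : ℝ) = 2 * 2 ^ n := by rw [hNeq]; push_cast; ring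
  have hsc : ∀ i : ℕ, sectorCenter n i = sectorWidth n / 2 + i * sectorWidth n := sectorCenter_eq n
  -- the constraints imply the `c'`-thick shell
  have hSf' : ∀ j k, (∀ i, |k i| < Real.pi) → Sf j k → |sqDispersion k - μ| ≤ c' * sectorWidth n :=
    fun j k hk hs => (hSf j k hk hs).trans (mul_le_mul_of_nonneg_right hcc' hwpos.le)
  have hS' : ∀ l k, (∀ i, |k i| < Real.pi) → S l k → |sqDispersion k - μ| ≤ c' * sectorWidth n :=
    fun l k hk hs => (hS l k hk hs).trans (mul_le_mul_of_nonneg_right hcc' hwpos.le)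
  clear hSf hS
  generalize hwdef : sectorWidth n = w at hwpos hNw h2n hsc hSf' hS' ⊢
  have hμab : μ ∈ Icc ((μ₁ - 4) / 2) (μ₂ / 2) := ⟨by linarith only [hμ.1, hμ₁], by linarith only [hμ.2, hμ₂]⟩
  have h2npos : (0 : ℝ) < 2 ^ n := by positivity
  -- the offset `P₀ = Σ_fixed p(θ_ω) - 2πG`
  set P₀ : ℝ × ℝ := (∑ j, bandX μ (w / 2 + (ωf j : ℝ) * w) - 2 * π * (G 0 : ℝ),
    ∑ j, bandY μ (w / 2 + (ωf j : ℝ) * w) - 2 * π * (G 1 : ℝ)) with hP₀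
  -- the trivial bound `N³`
  have htriv : ∀ (pr : Fin (sectorCount n) × Fin (sectorCount n) × Fin (sectorCount n) → Prop) [DecidablePred pr],
      ((((Finset.univ : Finset (Fin (sectorCount n) × Fin (sectorCount n) × Fin (sectorCount n))).filter pr).card : ℝ))
        ≤ (sectorCount n : ℝ) ^ 3 := by
    intro pr _
    have h1 := Finset.card_filter_le
      (Finset.univ : Finset (Fin (sectorCount n) × Fin (sectorCount n) × Fin (sectorCount n))) pr
    rw [Finset.card_univ, Fintype.card_prod, Fintype.card_prod, Fintype.card_fin] at h1
    calc _ ≤ ((sectorCount n * (sectorCount n * sectorCount n) : ℕ) : ℝ) := by exact_mod_cast h1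
      _ = (sectorCount n : ℝ) ^ 3 := by push_cast; ring
  by_cases hwle : w ≤ w₀
  · -- the main case
    have hw1 : w ≤ 1 := hwle.trans (by rw [hw₀]; exact min_le_left _ _)
    have hwm' : w ≤ m₀ / c' := hwle.trans (by rw [hw₀]; exact (min_le_right _ _).trans (min_le_left _ _))
    have hwη : w ≤ m₀ / (2 * Cδ) := hwle.trans (by rw [hw₀]; exact (min_le_right _ _).trans (min_le_right _ _))
    have hcwm : c' * w ≤ m₀ := by
      have := mul_le_mul_of_nonneg_left hwm' hc'pos.le
      have e : c' * (m₀ / c') = m₀ := by field_simp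
      rw [e] at this; exact this
    have h2δ : Cδ * w ≤ m₀ / 2 := by
      have := mul_le_mul_of_nonneg_left hwη hCδpos.le
      have e : Cδ * (m₀ / (2 * Cδ)) = m₀ / 2 := by field_simp
      rw [e] at this; exact this
    have hm1 : m₀ ≤ μ₁ - (μ₁ - 4) / 2 := min_le_left _ _
    have hm2 : m₀ ≤ μ₂ / 2 - μ₂ := min_le_right _ _
    have hlo : (μ₁ - 4) / 2 ≤ μ - m₀ := by linarith only [hμ.1, hm1]
    have hhi : μ + m₀ ≤ μ₂ / 2 := by linarith only [hμ.2, hm2]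
    -- Step 1: the admissible triples have `P₀ + Σ p(θ_ω)` close to `0`
    set r : ℝ := (((m : ℝ) + 3) * c' * B.Dcell + s') * w with hr
    have hr0 : 0 ≤ r := by positivity
    have hsub : (Finset.univ : Finset (Fin (sectorCount n) × Fin (sectorCount n) × Fin (sectorCount n))).filter
        (fun ω : Fin (sectorCount n) × Fin (sectorCount n) × Fin (sectorCount n) =>
          ∃ (kf : Fin m → Fin 2 → ℝ) (k : Fin 3 → Fin 2 → ℝ),
          (∀ j i, |kf j i| < Real.pi) ∧ (∀ l i, |k l i| < Real.pi) ∧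
          (∀ j, Sf j (kf j)) ∧ (∀ l, S l (k l)) ∧
          (∀ j, sectorIndex n (Complex.arg (⟨kf j 0, kf j 1⟩ : ℂ)) = ωf j) ∧
          sectorIndex n (Complex.arg (⟨k 0 0, k 0 1⟩ : ℂ)) = (ω.1 : ℕ) ∧
          sectorIndex n (Complex.arg (⟨k 1 0, k 1 1⟩ : ℂ)) = (ω.2.1 : ℕ) ∧
          sectorIndex n (Complex.arg (⟨k 2 0, k 2 1⟩ : ℂ)) = (ω.2.2 : ℕ) ∧
          (∀ i, |(∑ j, kf j i) + (∑ l, k l i) - 2 * Real.pi * (G i : ℝ)| ≤ s * w)) ⊆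
      (Finset.univ : Finset (Fin (sectorCount n) × Fin (sectorCount n) × Fin (sectorCount n))).filter
        (fun ω : Fin (sectorCount n) × Fin (sectorCount n) × Fin (sectorCount n) =>
        |P₀.1 + bandX μ (w / 2 + ((ω.1 : ℕ) : ℝ) * w) + bandX μ (w / 2 + ((ω.2.1 : ℕ) : ℝ) * w) +
            bandX μ (w / 2 + ((ω.2.2 : ℕ) : ℝ) * w)| ≤ r ∧
        |P₀.2 + bandY μ (w / 2 + ((ω.1 : ℕ) : ℝ) * w) + bandY μ (w / 2 + ((ω.2.1 : ℕ) : ℝ) * w) +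
            bandY μ (w / 2 + ((ω.2.2 : ℕ) : ℝ) * w)| ≤ r) := by
      intro ω hω
      rw [Finset.mem_filter] at hω
      obtain ⟨-, kf, k, hkf, hk, hshf, hsh, hif, hi0, hi1, hi2, hsum⟩ := hω
      have hcwm' : c' * sectorWidth n ≤ m₀ := by rw [hwdef]; exact hcwm
      have cf : ∀ j, |kf j 0 - bandX μ (w / 2 + (ωf j : ℝ) * w)| ≤ c' * B.Dcell * w ∧
          |kf j 1 - bandY μ (w / 2 + (ωf j : ℝ) * w)| ≤ c' * B.Dcell * w := by
        intro j
        have cj := h10_cell_thick_mul B hμab hc'1 (hkf j)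
          (by rw [hwdef]; exact hSf' j (kf j) (hkf j) (hshf j)) hcwm' hlo hhi (hif j)
        rw [hsc, hwdef] at cj
        exact cj
      have c0 := h10_cell_thick_mul B hμab hc'1 (hk 0)
        (by rw [hwdef]; exact hS' 0 (k 0) (hk 0) (hsh 0)) hcwm' hlo hhi hi0
      have c1 := h10_cell_thick_mul B hμab hc'1 (hk 1)
        (by rw [hwdef]; exact hS' 1 (k 1) (hk 1) (hsh 1)) hcwm' hlo hhi hi1
      have c2 := h10_cell_thick_mul B hμab hc'1 (hk 2)
        (by rw [hwdef]; exact hS' 2 (k 2) (hk 2) (hsh 2)) hcwm' hlo hhi hi2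
      rw [hsc, hwdef] at c0 c1 c2
      rw [Finset.mem_filter]
      refine ⟨Finset.mem_univ _, ?_, ?_⟩
      · have hs : |(∑ j, kf j 0) + (k 0 0 + k 1 0 + k 2 0) - 2 * π * (G 0 : ℝ)| ≤ s' * w := by
          have := hsum 0
          rw [Fin.sum_univ_three] at this
          exact this.trans (mul_le_mul_of_nonneg_right hss' hwpos.le)
        have hfix : |∑ j, (kf j 0 - bandX μ (w / 2 + (ωf j : ℝ) * w))| ≤ (m : ℝ) * (c' * B.Dcell * w) := by
          calc |∑ j, (kf j 0 - bandX μ (w / 2 + (ωf j : ℝ) * w))|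
              ≤ ∑ j, |kf j 0 - bandX μ (w / 2 + (ωf j : ℝ) * w)| := Finset.abs_sum_le_sum_abs _ _
            _ ≤ ∑ _j : Fin m, c' * B.Dcell * w := Finset.sum_le_sum fun j _ => (cf j).1
            _ = (m : ℝ) * (c' * B.Dcell * w) := by
                rw [Finset.sum_const, Finset.card_univ, Fintype.card_fin, nsmul_eq_mul]
        have e : P₀.1 + bandX μ (w / 2 + ((ω.1 : ℕ) : ℝ) * w) + bandX μ (w / 2 + ((ω.2.1 : ℕ) : ℝ) * w) +
            bandX μ (w / 2 + ((ω.2.2 : ℕ) : ℝ) * w) =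
            -(∑ j, (kf j 0 - bandX μ (w / 2 + (ωf j : ℝ) * w))) +
            (-(k 0 0 - bandX μ (w / 2 + ((ω.1 : ℕ) : ℝ) * w)) + -(k 1 0 - bandX μ (w / 2 + ((ω.2.1 : ℕ) : ℝ) * w)) +
            -(k 2 0 - bandX μ (w / 2 + ((ω.2.2 : ℕ) : ℝ) * w))) +
            ((∑ j, kf j 0) + (k 0 0 + k 1 0 + k 2 0) - 2 * π * (G 0 : ℝ)) := by
          rw [hP₀]; dsimp only
          rw [Finset.sum_sub_distrib]
          ring
        rw [e]
        calc _ ≤ |-(∑ j, (kf j 0 - bandX μ (w / 2 + (ωf j : ℝ) * w)))| +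
              (|-(k 0 0 - bandX μ (w / 2 + ((ω.1 : ℕ) : ℝ) * w))| + |-(k 1 0 - bandX μ (w / 2 + ((ω.2.1 : ℕ) : ℝ) * w))| +
              |-(k 2 0 - bandX μ (w / 2 + ((ω.2.2 : ℕ) : ℝ) * w))|) +
              |(∑ j, kf j 0) + (k 0 0 + k 1 0 + k 2 0) - 2 * π * (G 0 : ℝ)| := by
              refine (abs_add_le _ _).trans (add_le_add ((abs_add_le _ _).trans (add_le_add le_rfl
                ((abs_add_le _ _).trans (add_le_add (abs_add_le _ _) le_rfl)))) le_rfl)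
          _ ≤ (m : ℝ) * (c' * B.Dcell * w) + (c' * B.Dcell * w + c' * B.Dcell * w + c' * B.Dcell * w) + s' * w := by
              rw [abs_neg, abs_neg, abs_neg, abs_neg]
              exact add_le_add (add_le_add hfix (add_le_add (add_le_add c0.1 c1.1) c2.1)) hs
          _ = r := by rw [hr]; ring
      · have hs : |(∑ j, kf j 1) + (k 0 1 + k 1 1 + k 2 1) - 2 * π * (G 1 : ℝ)| ≤ s' * w := by
          have := hsum 1
          rw [Fin.sum_univ_three] at this
          exact this.trans (mul_le_mul_of_nonneg_right hss' hwpos.le)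
        have hfix : |∑ j, (kf j 1 - bandY μ (w / 2 + (ωf j : ℝ) * w))| ≤ (m : ℝ) * (c' * B.Dcell * w) := by
          calc |∑ j, (kf j 1 - bandY μ (w / 2 + (ωf j : ℝ) * w))|
              ≤ ∑ j, |kf j 1 - bandY μ (w / 2 + (ωf j : ℝ) * w)| := Finset.abs_sum_le_sum_abs _ _
            _ ≤ ∑ _j : Fin m, c' * B.Dcell * w := Finset.sum_le_sum fun j _ => (cf j).2
            _ = (m : ℝ) * (c' * B.Dcell * w) := by
                rw [Finset.sum_const, Finset.card_univ, Fintype.card_fin, nsmul_eq_mul]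
        have e : P₀.2 + bandY μ (w / 2 + ((ω.1 : ℕ) : ℝ) * w) + bandY μ (w / 2 + ((ω.2.1 : ℕ) : ℝ) * w) +
            bandY μ (w / 2 + ((ω.2.2 : ℕ) : ℝ) * w) =
            -(∑ j, (kf j 1 - bandY μ (w / 2 + (ωf j : ℝ) * w))) +
            (-(k 0 1 - bandY μ (w / 2 + ((ω.1 : ℕ) : ℝ) * w)) + -(k 1 1 - bandY μ (w / 2 + ((ω.2.1 : ℕ) : ℝ) * w)) +
            -(k 2 1 - bandY μ (w / 2 + ((ω.2.2 : ℕ) : ℝ) * w))) +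
            ((∑ j, kf j 1) + (k 0 1 + k 1 1 + k 2 1) - 2 * π * (G 1 : ℝ)) := by
          rw [hP₀]; dsimp only
          rw [Finset.sum_sub_distrib]
          ring
        rw [e]
        calc _ ≤ |-(∑ j, (kf j 1 - bandY μ (w / 2 + (ωf j : ℝ) * w)))| +
              (|-(k 0 1 - bandY μ (w / 2 + ((ω.1 : ℕ) : ℝ) * w))| + |-(k 1 1 - bandY μ (w / 2 + ((ω.2.1 : ℕ) : ℝ) * w))| +
              |-(k 2 1 - bandY μ (w / 2 + ((ω.2.2 : ℕ) : ℝ) * w))|) +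
              |(∑ j, kf j 1) + (k 0 1 + k 1 1 + k 2 1) - 2 * π * (G 1 : ℝ)| := by
              refine (abs_add_le _ _).trans (add_le_add ((abs_add_le _ _).trans (add_le_add le_rfl
                ((abs_add_le _ _).trans (add_le_add (abs_add_le _ _) le_rfl)))) le_rfl)
          _ ≤ (m : ℝ) * (c' * B.Dcell * w) + (c' * B.Dcell * w + c' * B.Dcell * w + c' * B.Dcell * w) + s' * w := by
              rw [abs_neg, abs_neg, abs_neg, abs_neg]
              exact add_le_add (add_le_add hfix (add_le_add (add_le_add c0.2 c1.2) c2.2)) hs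
          _ = r := by rw [hr]; ring
    -- Step 2: eliminate the last index
    have hT'le : ((((Finset.univ : Finset (Fin (sectorCount n) × Fin (sectorCount n) × Fin (sectorCount n))).filter
        (fun ω : Fin (sectorCount n) × Fin (sectorCount n) × Fin (sectorCount n) =>
        |P₀.1 + bandX μ (w / 2 + ((ω.1 : ℕ) : ℝ) * w) + bandX μ (w / 2 + ((ω.2.1 : ℕ) : ℝ) * w) +
            bandX μ (w / 2 + ((ω.2.2 : ℕ) : ℝ) * w)| ≤ r ∧
        |P₀.2 + bandY μ (w / 2 + ((ω.1 : ℕ) : ℝ) * w) + bandY μ (w / 2 + ((ω.2.1 : ℕ) : ℝ) * w) +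
            bandY μ (w / 2 + ((ω.2.2 : ℕ) : ℝ) * w)| ≤ r)).card : ℝ)) ≤
        C₀ * ((((Finset.range (sectorCount n) ×ˢ Finset.range (sectorCount n)).filter fun p : ℕ × ℕ =>
          |eps2 (P₀.1 + bandX μ (w / 2 + p.1 * w) + bandX μ (w / 2 + p.2 * w))
            (P₀.2 + bandY μ (w / 2 + p.1 * w) + bandY μ (w / 2 + p.2 * w)) - μ| ≤ Cδ * w).card : ℝ)) := by
      refine card_prod3_le (N := sectorCount n)
        (Q := fun i c d => |P₀.1 + bandX μ (w / 2 + i * w) + bandX μ (w / 2 + c * w) + bandX μ (w / 2 + d * w)| ≤ r ∧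
          |P₀.2 + bandY μ (w / 2 + i * w) + bandY μ (w / 2 + c * w) + bandY μ (w / 2 + d * w)| ≤ r)
        (R := fun i c => |eps2 (P₀.1 + bandX μ (w / 2 + i * w) + bandX μ (w / 2 + c * w))
            (P₀.2 + bandY μ (w / 2 + i * w) + bandY μ (w / 2 + c * w)) - μ| ≤ Cδ * w) hC₀pos.le ?_ ?_
      · intro i c hi hc
        have hbox := card_grid_in_box_le B hμab hwpos hNw hr0 (N := sectorCount n)
          (x := -(P₀.1 + bandX μ (w / 2 + i * w) + bandX μ (w / 2 + c * w)))
          (y := -(P₀.2 + bandY μ (w / 2 + i * w) + bandY μ (w / 2 + c * w)))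
        have heq : ((Finset.range (sectorCount n)).filter fun d : ℕ =>
            |P₀.1 + bandX μ (w / 2 + i * w) + bandX μ (w / 2 + c * w) + bandX μ (w / 2 + d * w)| ≤ r ∧
            |P₀.2 + bandY μ (w / 2 + i * w) + bandY μ (w / 2 + c * w) + bandY μ (w / 2 + d * w)| ≤ r) =
            ((Finset.range (sectorCount n)).filter fun d : ℕ =>
            |bandX μ (w / 2 + d * w) - -(P₀.1 + bandX μ (w / 2 + i * w) + bandX μ (w / 2 + c * w))| ≤ r ∧
            |bandY μ (w / 2 + d * w) - -(P₀.2 + bandY μ (w / 2 + i * w) + bandY μ (w / 2 + c * w))| ≤ r) := by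
          refine Finset.filter_congr fun d _ => ?_
          rw [show P₀.1 + bandX μ (w / 2 + i * w) + bandX μ (w / 2 + c * w) + bandX μ (w / 2 + d * w) =
            bandX μ (w / 2 + d * w) - -(P₀.1 + bandX μ (w / 2 + i * w) + bandX μ (w / 2 + c * w)) by ring,
            show P₀.2 + bandY μ (w / 2 + i * w) + bandY μ (w / 2 + c * w) + bandY μ (w / 2 + d * w) =
            bandY μ (w / 2 + d * w) - -(P₀.2 + bandY μ (w / 2 + i * w) + bandY μ (w / 2 + c * w)) by ring]
        rw [heq]
        refine hbox.trans (le_of_eq ?_)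
        rw [hC₀, hr]; field_simp
      · intro i c d hi hc hd hQ
        have := h10_abs_offsetLevel_le_of_sum B hμab hQ.1 hQ.2
        have e : 4 * r = Cδ * w := by rw [hr, hCδ]; ring
        linarith
    -- Step 3: the two-dimensional count with the offset `P₀`
    have hP := hcount μ hμab hlo hhi P₀ w (sectorCount n) (2 ^ n) n hwpos hw1 hNw
      (by push_cast; exact h2n) hNeq h2n h2δ
    clear hcount
    -- Step 4: arithmetic
    have hlogN : Real.log (sectorCount n : ℕ) ≤ (n : ℝ) + 1 := by rw [hNreal]; exact log_two_mul_two_pow_le n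
    have hwinv : 1 / w = 2 ^ n / π := by rw [← h2n]; field_simp
    have e1 := Finset.card_le_card hsub
    have e1' : ((((Finset.univ : Finset (Fin (sectorCount n) × Fin (sectorCount n) × Fin (sectorCount n))).filter
        (fun ω : Fin (sectorCount n) × Fin (sectorCount n) × Fin (sectorCount n) =>
          ∃ (kf : Fin m → Fin 2 → ℝ) (k : Fin 3 → Fin 2 → ℝ),
          (∀ j i, |kf j i| < Real.pi) ∧ (∀ l i, |k l i| < Real.pi) ∧
          (∀ j, Sf j (kf j)) ∧ (∀ l, S l (k l)) ∧
          (∀ j, sectorIndex n (Complex.arg (⟨kf j 0, kf j 1⟩ : ℂ)) = ωf j) ∧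
          sectorIndex n (Complex.arg (⟨k 0 0, k 0 1⟩ : ℂ)) = (ω.1 : ℕ) ∧
          sectorIndex n (Complex.arg (⟨k 1 0, k 1 1⟩ : ℂ)) = (ω.2.1 : ℕ) ∧
          sectorIndex n (Complex.arg (⟨k 2 0, k 2 1⟩ : ℂ)) = (ω.2.2 : ℕ) ∧
          (∀ i, |(∑ j, kf j i) + (∑ l, k l i) - 2 * Real.pi * (G i : ℝ)| ≤ s * w))).card : ℝ)) ≤
        K₂ * 2 ^ n * ((n : ℝ) + 1) := by
      have e2 : Kp * ((n : ℝ) + 2 + Real.log (sectorCount n : ℕ)) / w ≤ Kp * (3 * ((n : ℝ) + 1)) / w := by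
        apply div_le_div_of_nonneg_right _ hwpos.le
        apply mul_le_mul_of_nonneg_left _ hKp.le
        linarith only [hlogN]
      have e3 : Kp * (3 * ((n : ℝ) + 1)) / w = Kp * 3 / π * 2 ^ n * ((n : ℝ) + 1) := by
        rw [div_eq_mul_one_div _ w, hwinv]; ring
      have e4 : C₀ * (Kp * 3 / π * 2 ^ n * ((n : ℝ) + 1)) = K₂ * 2 ^ n * ((n : ℝ) + 1) := by rw [hK₂]; ring
      calc _ ≤ _ := by exact_mod_cast e1
        _ ≤ C₀ * (Kp * ((n : ℝ) + 2 + Real.log (sectorCount n : ℕ)) / w) :=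
            hT'le.trans (mul_le_mul_of_nonneg_left hP hC₀pos.le)
        _ ≤ C₀ * (Kp * (3 * ((n : ℝ) + 1)) / w) := mul_le_mul_of_nonneg_left e2 hC₀pos.le
        _ = K₂ * 2 ^ n * ((n : ℝ) + 1) := by rw [e3, e4]
    refine e1'.trans ?_
    have : 0 ≤ K₁ * 2 ^ n * ((n : ℝ) + 1) := by positivity
    linarith only [this]
  · -- small `n`: `2ⁿ < π / w₀`
    clear hcount
    push Not at hwle
    have h2nlt : (2 : ℝ) ^ n ≤ π / w₀ := by
      rw [le_div_iff₀ hw₀pos, ← h2n]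
      exact mul_le_mul_of_nonneg_left hwle.le h2npos.le
    have hbound : (sectorCount n : ℝ) ^ 3 ≤ K₁ * 2 ^ n := by
      rw [hNreal, hK₁]
      have hsq : ((2 : ℝ) ^ n) ^ 2 ≤ (π / w₀) ^ 2 := pow_le_pow_left₀ h2npos.le h2nlt 2
      have e : (2 * (2 : ℝ) ^ n) ^ 3 = 8 * ((2 : ℝ) ^ n) ^ 2 * 2 ^ n := by ring
      rw [e]
      exact mul_le_mul_of_nonneg_right (mul_le_mul_of_nonneg_left hsq (by norm_num)) h2npos.le
    refine (htriv _).trans (hbound.trans ?_)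
    have h1 : K₁ * 2 ^ n ≤ (K₁ + K₂) * 2 ^ n := mul_le_mul_of_nonneg_right (by linarith only [hK₂pos]) h2npos.le
    have h2 : (K₁ + K₂) * 2 ^ n ≤ (K₁ + K₂) * 2 ^ n * ((n : ℝ) + 1) :=
      le_mul_of_one_le_right (by positivity) (by linarith only [(by positivity : (0:ℝ) ≤ n)])
    linarith only [h1, h2]

end Summit.HubbardSuperconductivity.HubbardSuperconductivity.Theorems

end
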